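import Summits.QuantumFields.BalabanUV.Beta.EriceFlowEnclosureB12AsPrintedHistoryContagionShiftFlowZeroSemigroupVelocityWitness
import Summits.QuantumFields.BalabanUV.Beta.EriceFlowEnclosureB12AsPrintedHistoryContagionShiftFlowZeroLambda

/-!
# Beta / EriceFlowEnclosureB12AsPrintedHistoryContagionShiftFlowZeroSemigroupVelocityWitnessEnd — ASYMPTOTIC FREEDOM IS CONTAGIOUS, part 63: THE KINK WITNESS IS
# INHABITED — a CLOSED existence theorem: **there is a functional with node U2's memory profile and a value at the zero history whose relative Λ-parameter near the zero
# pin is differentiable ALMOST everywhere but NOT everywhere.**  Part 62 proved the implication under the standing package hypotheses of the row; here EVERY hypothesis is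
# discharged for the def-free toy `B(u) = 1 + min(u₀, a)` with the concrete data **`θ = 0`, `C_m = 1`, `γ = g* = 1∕2`, `β* = 1`, `β₀ = 1`, `e′ = 1∕100`, `a = 1∕200`**:
# (§102) the toy is floored by 1, so node U2's ORIGINAL contraction regime (`C_mγ < β*(1−θ)`, i.e. `1∕2 < 1`) gives the AF reference `t = solution B (1∕2)` with
# `1∕t(m)² ≥ 1∕(1∕2)² + m` (`floor_profile`: any solution of a flow floored by 1 gains at least 1 per step in the chart) and the box solution from the reference pin;
# part 14's package at `e′ = 1∕100` is four numerical inequalities (`norm_num`); part 35's `relativeLambda_exists` supplies THE relative Λ-parameter (a dynamical Abel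
# function, strictly antitone, onto, chart bounds, Abel equation); the kink at `a = e′∕2` sits one backward step inside the box (`Λ a − Λ e′ ≥ (2∕3)(1∕a² − 1∕e′²) =
# 2∕e′² > 1 = β₀`); part 62 concludes.  HEADLINE **`exists_abel_ae_not_everywhere`**: ∃ B, γ, e′, Λ, h′ with `MemoryProfile 1 0 γ B`, `|B u − 1| ≤ Σ 0^j u_j`, h′ a box
# solution from e′, Λ THE relative Λ-parameter (`1∕h(n)² − 1∕h′(n)² → Λ e` along every box solution from every pin of ]0, e′], `Λ e′ = 0`, strictly antitone, Abel equation
# `Λ(h k) = Λ e + k`), **Λ differentiable at a.e. coupling of ]0, e′[ and NOT differentiable at some coupling of ]0, e′[**.  So parts 55–58's «almost every» is OPTIMAL on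
# the class «memory profile + value at zero», and part 60's everywhere-smooth theory needs MORE than node U2's letters.
# (β-flow team, prover 1 = recursion ∕ upper ∕ bare-coupling ∕ uniqueness side, unit `b2b-balaban-beta-bflow-p1`, gen 41; ROW AP-I·Uc × NODE U2 — the witness inhabited;
# over part 62, part 35 `…ShiftFlowZeroLambda` (`relativeLambda_exists`), part 13 (`memFlow_solution_of_reference`), node U2's `T4BetaFlowWellPosed.{solution_seqBox,
# memFlow_solution}` (§4, the original contraction regime) BY NAME)

HONEST FRAMING (page 1 of everything the β sub-cell writes): discharging `BetaPertH` makes Bałaban's UV stability UNCONDITIONAL — a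
real constructive-QFT result; it is NOT the continuum limit and NOT the Clay problem.  HONEST DEPENDENCY (cell reorg 2026-08-19,
verbatim): «continuum YM on T⁴ ⇐ BetaPertH ∧ nine spine estimates (0/9 proved); BetaPertH ⇐ (D1) ∧ (D4) ∧ CAP+tail; G-an2-4 gates
asym, D1 and NE2/3/4.»  THIS MODULE DISCHARGES NOTHING of the programme: it inhabits the hypotheses of the row's own witness (part 62) with a def-free TOY (NOT Bałaban's
β, no claim about it) and explicit rational data; node U2's §4 and parts 13 ∕ 35 ∕ 62 BY NAME.  [I] THEOREM 2 does not occur.  [I] = T. Bałaban, Commun. Math. Phys. **109**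
(1987) 249–301 [Balaban1987RG1]: Thm 2 (0.31) p. 259 — context of the row only.

WHAT THIS FILE PROVES (0 sorry, 0 def): §102 `floor_profile`, `kink_package`, **`exists_abel_ae_not_everywhere`**.  NOT CLAIMED: anything about Bałaban's β;
`BetaPertH`; continuum; Clay.
-/

namespace Summit.QuantumFields.BalabanUV.Beta.EriceFlowEnclosureB12AsPrintedHistoryContagionShiftFlowZeroSemigroupVelocityWitnessEnd

open Filter Topology Set Function MeasureTheory
open Literature.MathematicalPhysics.QuantumFieldTheory.Balaban1983to89
open Literature.MathematicalPhysics.QuantumFieldTheory.Balaban1983to89.T4BetaStationary (SeqBox MemoryProfile)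
open Literature.MathematicalPhysics.QuantumFieldTheory.Balaban1983to89.T4BetaFlowWellPosed (MemFlow solution solution_seqBox memFlow_solution)
open Summit.QuantumFields.BalabanUV.Beta.EriceFlowEnclosureB12AsPrintedHistoryContagionShiftFlowPicardLimit (memFlow_solution_of_reference)
open Summit.QuantumFields.BalabanUV.Beta.EriceFlowEnclosureB12AsPrintedHistoryContagionShiftFlowZeroLambda (relativeLambda_exists)
open Summit.QuantumFields.BalabanUV.Beta.EriceFlowEnclosureB12AsPrintedHistoryContagionShiftFlowZeroSemigroupVelocityWitness (kinkB_memoryProfile kinkB_valueAtZero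
  kinkB_ge_one kink_ae_not_everywhere)

noncomputable section

/-! ## §102 Discharging every hypothesis of the kink witness with explicit data -/

/-- Any solution of a flow FLOORED BY 1 on the box gains at least one unit per step in the chart: `1∕h(m)² ≥ 1∕g² + m`. [folklore] -/
theorem floor_profile {B : (ℕ → ℝ) → ℝ} {γ g : ℝ} {h : ℕ → ℝ} (hlo : ∀ u : ℕ → ℝ, SeqBox γ u → (1 : ℝ) ≤ B u) (hhs : SeqBox γ h) (hhf : MemFlow B g h) :
    ∀ m : ℕ, 1 / g ^ 2 + 1 * (m : ℝ) ≤ 1 / (h m) ^ 2 := by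
  intro m
  induction m with
  | zero => simp [hhf.1]
  | succ k ih =>
    rw [hhf.2 k]
    have := hlo (fun j => h (k + 1 + j)) (fun j => hhs (k + 1 + j))
    push_cast
    linarith

/-- **THE PACKAGE, NUMERICALLY**: with `C_m = 1`, `θ = 0`, `β* = 1`, `g* = γ = 1∕2`, part 14's four inequalities and `2e′ ≤ γ` hold at `e′ = 1∕100`. [folklore] -/
theorem kink_package :
    4 * (1 : ℝ) * (1 / 100) ≤ 1 * (1 - 0) ∧
      (1 / 100 : ℝ) ^ 2 * (1 / (1 / 2) ^ 2 + 1 * (1 / 2) / (1 - 0) ^ 2 + (2 * 1 / ((1 - 0) * 1)) ^ 2) ≤ 3 / 4 ∧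
      64 * (1 : ℝ) * (1 / 100) ^ 3 ≤ (1 - 0) ^ 2 ∧ (1 : ℝ) * (8 * (1 / 100) ^ 3 + 16 * (1 / 100) / 1) ≤ (1 - 0) / 4 ∧
      2 * (1 / 100 : ℝ) ≤ 1 / 2 := by
  norm_num

/-- **THERE IS A MEMORY FUNCTIONAL WHOSE Λ-COORDINATE IS DIFFERENTIABLE ALMOST EVERYWHERE BUT NOT EVERYWHERE.**  Concretely `B(u) = 1 + min(u₀, 1∕200)` on ]0, 1∕2]^ℕ
(memory profile `(C_m, θ) = (1, 0)`, value 1 at the zero history in part 32's letter shape), reference pin `e′ = 1∕100` with its box solution h′: the relative Λ-parameter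
Λ of part 35 (`Λ e′ = 0`; `1∕h(n)² − 1∕h′(n)² → Λ e` along EVERY box solution h from EVERY pin `e ∈ ]0, e′]`; strictly antitone; Abel equation `Λ(h k) = Λ e + k·1`) is
**differentiable at Lebesgue-a.e. coupling of ]0, e′[ and NOT differentiable at some coupling of ]0, e′[**.  The a.e. qualifier of parts 55–58 is optimal on the class
«memory profile + value at the zero history». [folklore] -/
theorem exists_abel_ae_not_everywhere :
    ∃ (B : (ℕ → ℝ) → ℝ) (γ e' : ℝ) (h' : ℕ → ℝ) (Λ : ℝ → ℝ),
      MemoryProfile 1 0 γ B ∧ (∀ u : ℕ → ℝ, SeqBox γ u → |B u - 1| ≤ 1 * ∑' j, (0 : ℝ) ^ j * u j) ∧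
      0 < e' ∧ 2 * e' ≤ γ ∧ SeqBox γ h' ∧ MemFlow B e' h' ∧ Λ e' = 0 ∧
      (∀ e ∈ Ioc (0 : ℝ) e', ∀ h : ℕ → ℝ, SeqBox γ h → MemFlow B e h → Tendsto (fun n => 1 / h n ^ 2 - 1 / h' n ^ 2) atTop (𝓝 (Λ e))) ∧
      StrictAntiOn Λ (Ioc 0 e') ∧
      (∀ e ∈ Ioc (0 : ℝ) e', ∀ h : ℕ → ℝ, SeqBox γ h → MemFlow B e h → ∀ k : ℕ, Λ (h k) = Λ e + (k : ℝ) * 1) ∧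
      (∀ᵐ x, x ∈ Ioo (0 : ℝ) e' → DifferentiableAt ℝ Λ x) ∧ ∃ x ∈ Ioo (0 : ℝ) e', ¬ DifferentiableAt ℝ Λ x := by
  -- the data
  set a : ℝ := 1 / 200 with hadef
  set B : (ℕ → ℝ) → ℝ := fun u => 1 + min (u 0) a with hBdef
  have ha0 : (0 : ℝ) ≤ a := by norm_num [hadef]
  have hθ0 : (0 : ℝ) ≤ 0 := le_rfl
  have hθ1 : (0 : ℝ) < 1 := one_pos
  have hB : MemoryProfile 1 0 (1 / 2) B := kinkB_memoryProfile hθ0 hθ1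
  have h0 : ∀ u : ℕ → ℝ, SeqBox (1 / 2) u → |B u - 1| ≤ 1 * ∑' j, (0 : ℝ) ^ j * u j := kinkB_valueAtZero hθ0 hθ1 ha0
  have hlo : ∀ u : ℕ → ℝ, SeqBox (1 / 2) u → (1 : ℝ) ≤ B u := kinkB_ge_one ha0
  -- the AF reference from node U2's original contraction regime (floor 1, `C_m γ = 1∕2 < 1 = β*(1 − θ)`)
  have hsmall : (1 : ℝ) * (1 / 2) < 1 * (1 - 0) := by norm_num
  have hts : SeqBox (1 / 2) (solution B (1 / 2)) := solution_seqBox hB zero_le_one hθ0 hθ1 (by norm_num) le_rfl one_pos hlo hsmall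
  have htf : MemFlow B (1 / 2) (solution B (1 / 2)) := memFlow_solution hB zero_le_one hθ0 hθ1 (by norm_num) le_rfl one_pos hlo hsmall
  have hprof : ∀ m : ℕ, 1 / (1 / 2 : ℝ) ^ 2 + 1 * (m : ℝ) ≤ 1 / (solution B (1 / 2) m) ^ 2 := floor_profile hlo hts htf
  -- the package at e′ = 1∕100 and the box solution from the reference pin
  obtain ⟨hs1, hs2, hs4, hs5, h2e'⟩ := kink_package
  have he' : (0 : ℝ) < 1 / 100 := by norm_num
  obtain ⟨hhs', hhf', -, -⟩ := memFlow_solution_of_reference hB zero_le_one hθ0 hθ1 one_pos (by norm_num : (0 : ℝ) < 1 / 2) hts htf hprof he' h2e' hs1 hs2 hs4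
  -- THE relative Λ-parameter
  obtain ⟨Λ, hΛ0, hΛh, hbounds, hanti, -, habel, huniq⟩ :=
    relativeLambda_exists hB zero_le_one hθ0 hθ1 one_pos (by norm_num : (0 : ℝ) < 1 / 2) h0 hts htf hprof he' h2e' hs1 hs2 hs4 hs5 hhs' hhf'
  have honto : ∀ y : ℝ, Λ (1 / 100) ≤ y → ∃ x ∈ Ioc (0 : ℝ) (1 / 100), Λ x = y := by
    intro y hy
    rw [hΛ0] at hy
    obtain ⟨x, ⟨hx, hxy⟩, -⟩ := huniq y hy
    exact ⟨x, hx, hxy⟩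
  -- the kink sits one backward step inside the box
  have hamem : a ∈ Ioo (0 : ℝ) (1 / 100) := by constructor <;> norm_num [hadef]
  have hdeep : Λ (1 / 100) + 1 < Λ a := by
    have h := (hbounds a ⟨hamem.1, hamem.2.le⟩ (1 / 100) ⟨he', le_rfl⟩ hamem.2.le).1
    have : (2 : ℝ) / 3 * (1 / a ^ 2 - 1 / (1 / 100) ^ 2) = 20000 := by norm_num [hadef]
    linarith
  obtain ⟨hae, hnot⟩ := kink_ae_not_everywhere hB zero_le_one hθ0 hθ1 one_pos (by norm_num : (0 : ℝ) < 1 / 2) h0 hts htf hprof hΛh hanti honto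
    one_pos h2e' hs1 hs2 hs4 hs5 hamem hdeep
  exact ⟨B, 1 / 2, 1 / 100, solution B (1 / 100), Λ, hB, h0, he', h2e', hhs', hhf', hΛ0, hΛh, hanti, habel, hae, hnot⟩

end

end Summit.QuantumFields.BalabanUV.Beta.EriceFlowEnclosureB12AsPrintedHistoryContagionShiftFlowZeroSemigroupVelocityWitnessEnd
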